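import Summits.AtomisticToContinuum.FouriersLaw.Theorems.LocalOhmBVBVProfileSeam

/-!
# Crux `BVProfile` (item stmt-AtomisticToContinuum-12012), line `registered`: reductions to the sister cruxes

The two registered stubs of line `registered` are each verbatim WEAKER than a vetted crux of the sister route
`TransferKernelPositivity`:

* `TransferKernelPositivity.MonotoneProfile` (item stmt-AtomisticToContinuum-12008: bulk monotonicity of the response
  profile outside boundary layers of `N`-independent width `ℓ`) ⇒ the statement of `stub_boundedBackflow` with the same
  `ℓ` and `K = 0` (every bulk increment is `≤ 0`, so every positive part vanishes) —
  `boundedBackflow_of_monotoneProfile`;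
* `TransferKernelPositivity.Passivity` (item stmt-AtomisticToContinuum-12010: `|t| ≤ 1/2` for every profile limit) ⇒
  the statement of `stub_profileBound` with `B = 1/2` (used inline below).

With the landed seam (`Theorems/LocalOhmBVBVProfileSeam.lean`) this closes the crux MODULO the two existing items:
`Passivity → MonotoneProfile → BVProfile` at both route names (`localOhmBV_bvProfile_of_passivity_of_monotoneProfile`,
`transferKernelPositivity_bvProfile_of_passivity_of_monotoneProfile`), which is also the sister route's glue item
`TransferKernelPositivity.TPGlue` (stmt-AtomisticToContinuum-12013) with the constant `2ℓ + 1` replaced by the seam's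
`2·max 0 0 + 2·max (1/2) 0·(2ℓ+1) = 2ℓ + 1`. No definitions. [folklore]
-/

noncomputable section

open Finset

namespace Summit.AtomisticToContinuum.FouriersLaw.Theorems

/-- **`MonotoneProfile` ⇒ bounded backflow (the statement of stub `stub_boundedBackflow`, with `K = 0`).** Given the
boundary-layer width `ℓ` of `TransferKernelPositivity.MonotoneProfile`, on every bulk bond `(i, i+1)` with `ℓ ≤ i`
and `i + 1 + ℓ < N` the increment `θ(i+1) − θ(i)` is `≤ 0`, so its positive part is `0` and the backflow sum
vanishes. [folklore] -/
theorem boundedBackflow_of_monotoneProfile : Summit.AtomisticToContinuum.FouriersLaw.Theses.TransferKernelPositivity.MonotoneProfile → ∀ ω₂ lam β γ : ℝ, 0 < ω₂ → 0 < lam → 0 < β → 0 < γ → (∀ (N : ℕ) (T_L T_R : ℝ), 0 < T_L → 0 < T_R → ∀ μ ν : MeasureTheory.Measure (Literature.MathematicalPhysics.KineticTheory.HeatConduction.PhaseSpace N), (Literature.MathematicalPhysics.KineticTheory.HeatConduction.pinnedChain ω₂ lam β γ).IsSteadyState N T_L T_R μ → (Literature.MathematicalPhysics.KineticTheory.HeatConduction.pinnedChain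 ω₂ lam β γ).IsSteadyState N T_L T_R ν → μ = ν) → ∀ μ : (N : ℕ) → ℝ → ℝ → MeasureTheory.Measure (Literature.MathematicalPhysics.KineticTheory.HeatConduction.PhaseSpace N), (∀ (N : ℕ) (T_L T_R : ℝ), 0 < T_L → 0 < T_R → (Literature.MathematicalPhysics.KineticTheory.HeatConduction.pinnedChain ω₂ lam β γ).IsSteadyState N T_L T_R (μ N T_L T_R)) → ∀ T : ℝ, 0 < T → ∃ (ℓ : ℕ) (K : ℝ), ∀ (N : ℕ) (θ : Fin N → ℝ), (∀ i : Fin N, Filter.Tendsto (fun δ : ℝ => ((∫ x, (x.2 i) ^ 2 ∂(μ N (T + δ / 2) (T - δ / 2))) - ∫ x, (x.2 i) ^ 2 ∂(μ N T T)) / δ) (nhdsWithin 0 {(0 : ℝ)}ᶜ) (nhds (θ i))) → ∑ i : Fin N, ∑ j : Fin N, (if j.val = i.val + 1 ∧ ℓ ≤ i.val ∧ i.val + 1 + ℓ < N then max (θ j - θ i) 0 else 0) ≤ K := by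
  intro hM ω₂ lam β γ hω hl hβ hγ hU μ hμ T hT
  obtain ⟨ℓ, hℓ⟩ := hM ω₂ lam β γ hω hl hβ hγ hU μ hμ T hT
  refine ⟨ℓ, 0, fun N θ hθ => ?_⟩
  refine Finset.sum_nonpos fun i _ => Finset.sum_nonpos fun j _ => ?_
  split_ifs with h
  · obtain ⟨hj, hi, hN⟩ := h
    have hle : θ j ≤ θ i := hℓ N θ hθ i j hi (by omega) (by omega)
    rw [max_eq_right (by linarith)]
  · exact le_rfl

/-- **`Passivity → MonotoneProfile → LocalOhmBV.BVProfile`**: the crux of item stmt-AtomisticToContinuum-12012 closed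
MODULO the two vetted sister cruxes (items 12010, 12008), through the landed seam with `B = 1/2`, `K = 0`
(so `C = 2ℓ + 1`). [folklore] -/
theorem localOhmBV_bvProfile_of_passivity_of_monotoneProfile
    (hP : _root_.Summit.AtomisticToContinuum.FouriersLaw.Theses.TransferKernelPositivity.Passivity)
    (hM : _root_.Summit.AtomisticToContinuum.FouriersLaw.Theses.TransferKernelPositivity.MonotoneProfile) :
    _root_.Summit.AtomisticToContinuum.FouriersLaw.Theses.LocalOhmBV.BVProfile :=
  localOhmBV_bvProfile_of_sup_of_backflow
    (fun ω₂ lam β γ hω hl hβ hγ hU μ hμ T hT =>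
      ⟨1 / 2, fun N i t ht => hP ω₂ lam β γ hω hl hβ hγ hU μ hμ T hT N i t ht⟩)
    (boundedBackflow_of_monotoneProfile hM)

/-- **`Passivity → MonotoneProfile → TransferKernelPositivity.BVProfile`** (the shared item's sister-route name; this
is the statement of the glue item `TransferKernelPositivity.TPGlue`, stmt-AtomisticToContinuum-12013). [folklore] -/
theorem transferKernelPositivity_bvProfile_of_passivity_of_monotoneProfile
    (hP : _root_.Summit.AtomisticToContinuum.FouriersLaw.Theses.TransferKernelPositivity.Passivity)
    (hM : _root_.Summit.AtomisticToContinuum.FouriersLaw.Theses.TransferKernelPositivity.MonotoneProfile) :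
    _root_.Summit.AtomisticToContinuum.FouriersLaw.Theses.TransferKernelPositivity.BVProfile :=
  transferKernelPositivity_bvProfile_of_sup_of_backflow
    (fun ω₂ lam β γ hω hl hβ hγ hU μ hμ T hT =>
      ⟨1 / 2, fun N i t ht => hP ω₂ lam β γ hω hl hβ hγ hU μ hμ T hT N i t ht⟩)
    (boundedBackflow_of_monotoneProfile hM)

end Summit.AtomisticToContinuum.FouriersLaw.Theorems

end
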